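/-
Copyright (c) 2026. All rights reserved.
Released under Apache 2.0 license as described in the file LICENSE.
Authors: abc-iut cell, campaign-S prover seat abc-iut-S7.
-/
import Mathlib.NumberTheory.NumberField.Completion.FinitePlace
import Mathlib.Analysis.SpecialFunctions.Pow.NNReal
import Literature.NumberTheory.GaloisRepresentations.PadicAlgebraOfLocalField
import Literature.NumberTheory.NumberFields.CompletionLocalDegree
import Literature.IUT.LogVolume.AdelicPacketModel
import Literature.IUT.LogVolume.PadicBoxVolume
import HarnessLib

/-!
# The completion `F_v` as a normed `ℚ_p`-algebra: the rescaled absolute value `‖·‖_v^{1/n_v}`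

For a number field `F` and a finite place `v ∣ p`, Mathlib norms the completion `F_v = v.adicCompletion F`
by `‖x‖ = 𝐍(v)^{−ord_v(x)}` (the normalised absolute value = Haar modulus), whose restriction to `ℚ_p` is
`|·|_p^{n_v}`, `n_v = [F_v : ℚ_p] = e_v f_v` — so `F_v` is not a normed `ℚ_p`-ALGEBRA as it stands, while
the `[IUTchIV] §1` files of this programme (`Literature/IUT/LogVolume/`) are written for fields `K` with
`[NormedAlgebra ℚ_[p] K]` ("`k_i ⊆ ℚ̄_p` … `ord` normalized so that `ord(p) = 1`", [IUTchIV] Prop. 1.1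
p. 9).  This file supplies the bridge: the type synonym `RescaledCompletion F p v hv` — the same field
with the same uniform structure and the canonical `ℚ_p`-algebra structure
`LocalField.adicCompletionPadicAlgebra` — normed by **`‖x‖' = ‖x‖_v^{1/n_v}`** (the rank-one structure
with base `𝐍(v)^{1/n_v}`), which is a NORMED `ℚ_p`-ALGEBRA (`norm_algebraMap : ‖c‖' = |c|_p`),
ultrametric, complete, proper and nontrivially normed.  The key identity `‖algebraMap c‖_v = |c|_p^{n_v}`
is proved through Haar measure: both sides are the modulus of multiplication by `c` on the
`n_v`-dimensional `ℚ_p`-space `F_v` (`CompletionModel.distribHaarChar_eq_norm`,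
`PadicModule.distribHaarChar_units_smul`, `distribHaarChar_padic_eq_nnnorm`).
Classical: Neukirch, ANT, Ch. II (4.8) (extensions of absolute values along finite extensions) and
(5.2)/(6.8) (local degrees). [cite: NeukirchANT1999, Ch. II Thm. (4.8)]
-/

noncomputable section

open NumberField IsDedekindDomain MeasureTheory Metric Set Valuation.IsRankOneDiscrete
open scoped NNReal Pointwise
open Literature.NumberTheory.GaloisRepresentations

namespace Literature.NumberTheory.NumberFields

variable (F : Type) [Field F] [NumberField F] (p : ℕ) (v : HeightOneSpectrum (𝓞 F))

/-- The local degree `n_v := e_v · f_v` of the finite place `v` (`= [F_v : ℚ_p]` for `v ∣ p`,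
`CompletionLocalDegree.finrank_padic_adicCompletion_eq`). [cite: NeukirchANT1999, Ch. II Prop. (6.8)] -/
def localDeg : ℕ := v.asIdeal.ramificationIdx ℤ * v.asIdeal.inertiaDeg ℤ

/-- `0 < n_v`. [cite: NeukirchANT1999, Ch. II Prop. (6.8)] -/
theorem localDeg_pos : 0 < localDeg F v :=
  Nat.mul_pos (Ideal.ramificationIdx_pos _ _) (Ideal.inertiaDeg_pos _ _)

variable (hv : ((p : ℕ) : 𝓞 F) ∈ v.asIdeal)

/-- **The rescaled completion**: the field `F_v` (type synonym), to be normed by `‖·‖_v^{1/n_v}`.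
[cite: NeukirchANT1999, Ch. II Thm. (4.8)] -/
def RescaledCompletion (_hv : ((p : ℕ) : 𝓞 F) ∈ v.asIdeal) : Type := v.adicCompletion F

namespace RescaledCompletion

/-- Field structure (that of `F_v`). [cite: NeukirchANT1999, Ch. II Thm. (4.8)] -/
instance instField : Field (RescaledCompletion F p v hv) := inferInstanceAs (Field (v.adicCompletion F))

/-- Valuation structure (that of `F_v`), hence the same uniform structure and topology.
[cite: NeukirchANT1999, Ch. II Thm. (4.8)] -/
instance instValued : Valued (RescaledCompletion F p v hv) (WithZero (Multiplicative ℤ)) :=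
  inferInstanceAs (Valued (v.adicCompletion F) (WithZero (Multiplicative ℤ)))

/-- Completeness (that of `F_v`). [cite: NeukirchANT1999, Ch. II Thm. (4.8)] -/
instance instCompleteSpace : CompleteSpace (RescaledCompletion F p v hv) :=
  inferInstanceAs (CompleteSpace (v.adicCompletion F))

/-- The valuation is discrete of rank one (that of `F_v`). [cite: NeukirchANT1999, Ch. II Thm. (4.8)] -/
instance instIsRankOneDiscrete :
    (Valued.v : Valuation (RescaledCompletion F p v hv) (WithZero (Multiplicative ℤ))).IsRankOneDiscrete :=
  inferInstanceAs ((Valued.v : Valuation (v.adicCompletion F) (WithZero (Multiplicative ℤ))).IsRankOneDiscrete)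

/-- The rescaled base `𝐍(v)^{1/n_v}`. [cite: NeukirchANT1999, Ch. II Thm. (4.8)] -/
def base : ℝ≥0 := (Ideal.absNorm v.asIdeal : ℝ≥0) ^ (1 / (localDeg F v : ℝ))

/-- `1 < 𝐍(v)^{1/n_v}`. [cite: NeukirchANT1999, Ch. II Thm. (4.8)] -/
theorem one_lt_base : 1 < base F v :=
  NNReal.one_lt_rpow (HeightOneSpectrum.one_lt_absNorm_nnreal v)
    (div_pos one_pos (by exact_mod_cast localDeg_pos F v))

/-- The rank-one structure with base `𝐍(v)^{1/n_v}`. [cite: NeukirchANT1999, Ch. II Thm. (4.8)] -/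
instance instRankOne : (Valued.v : Valuation (RescaledCompletion F p v hv) (WithZero (Multiplicative ℤ))).RankOne :=
  rankOne (Valued.v : Valuation (RescaledCompletion F p v hv) (WithZero (Multiplicative ℤ))) (one_lt_base F v)

/-- **The rescaled norm**: `RescaledCompletion` is a normed field for `‖·‖' = 𝐍(v)^{−ord_v(·)/n_v}`
(Mathlib `Valued.toNormedField`; the uniform structure is that of `F_v`). [cite: NeukirchANT1999, Ch. II Thm. (4.8)] -/
instance instNormedField : NormedField (RescaledCompletion F p v hv) :=
  Valued.toNormedField (RescaledCompletion F p v hv) (WithZero (Multiplicative ℤ))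

/-- The identity map `F_v → RescaledCompletion` (a ring isomorphism). [cite: NeukirchANT1999, Ch. II Thm. (4.8)] -/
def of : v.adicCompletion F ≃+* RescaledCompletion F p v hv := RingEquiv.refl _

/-- The rank-one homomorphism of the rescaled structure, unfolded. [cite: NeukirchANT1999, Ch. II Thm. (4.8)] -/
theorem rescaled_rankOne_hom'_def :
    (instRankOne F p v hv).hom' = (WithZeroMulInt.toNNReal (zero_lt_one.trans (one_lt_base F v)).ne').comp
      (.ofClass (valueGroup₀_equiv_withZeroMulInt
        (Valued.v : Valuation (RescaledCompletion F p v hv) (WithZero (Multiplicative ℤ))))) := rfl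

/-- The valuation of `RescaledCompletion` is surjective (it is that of `F_v`).
[cite: NeukirchANT1999, Ch. II Thm. (4.8)] -/
theorem valued_surjective :
    Function.Surjective (Valued.v : Valuation (RescaledCompletion F p v hv) (WithZero (Multiplicative ℤ))) :=
  IsDedekindDomain.HeightOneSpectrum.valuedAdicCompletion_surjective F v

/-- **The rescaled norm in terms of the valuation**: `‖x‖' = toNNReal_{𝐍(v)^{1/n_v}} (v x)`.
[cite: NeukirchANT1999, Ch. II Thm. (4.8)] -/
theorem norm_def (x : RescaledCompletion F p v hv) :
    ‖x‖ = WithZeroMulInt.toNNReal (zero_lt_one.trans (one_lt_base F v)).ne' (Valued.v x) := by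
  simp [Valued.toNormedField.norm_def, Valuation.RankOne.hom, rescaled_rankOne_hom'_def,
    valueGroup₀_equiv_withZeroMulInt_restrict_apply_of_surjective (valued_surjective F p v hv)]

/-- `toNNReal` with a base raised to the power `s > 0` is `toNNReal` raised to `s`.
[cite: NeukirchANT1999, Ch. II Thm. (4.8)] -/
theorem toNNReal_rpow_base {b : ℝ≥0} (hb : b ≠ 0) {s : ℝ} (hs : 0 < s) (hbs : b ^ s ≠ 0)
    (t : WithZero (Multiplicative ℤ)) :
    WithZeroMulInt.toNNReal hbs t = (WithZeroMulInt.toNNReal hb t) ^ s := by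
  by_cases ht : t = 0
  · rw [WithZeroMulInt.toNNReal_pos_apply _ ht, WithZeroMulInt.toNNReal_pos_apply _ ht, NNReal.zero_rpow hs.ne']
  · rw [WithZeroMulInt.toNNReal_neg_apply _ ht, WithZeroMulInt.toNNReal_neg_apply _ ht,
      ← NNReal.rpow_intCast, ← NNReal.rpow_intCast, ← NNReal.rpow_mul, ← NNReal.rpow_mul, mul_comm]

/-- **`‖x‖' = ‖x‖_v^{1/n_v}`**: the rescaled norm is the `n_v`-th root of Mathlib's normalised norm on
`F_v`. [cite: NeukirchANT1999, Ch. II Thm. (4.8)] -/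
theorem norm_of (x : v.adicCompletion F) :
    ‖of F p v hv x‖ = ‖x‖ ^ (1 / (localDeg F v : ℝ)) := by
  rw [norm_def, NumberField.FinitePlace.norm_def, ← NNReal.coe_rpow]
  congr 1
  exact toNNReal_rpow_base (NumberField.HeightOneSpectrum.absNorm_ne_zero v)
    (div_pos one_pos (by exact_mod_cast localDeg_pos F v)) _ (Valued.v x)

/-- Conversely `‖x‖_v = (‖x‖')^{n_v}`. [cite: NeukirchANT1999, Ch. II Thm. (4.8)] -/
theorem norm_eq_norm_of_pow (x : v.adicCompletion F) :
    ‖x‖ = ‖of F p v hv x‖ ^ (localDeg F v) := by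
  have hn : (localDeg F v : ℝ) ≠ 0 := by exact_mod_cast (localDeg_pos F v).ne'
  rw [norm_of, ← Real.rpow_natCast, ← Real.rpow_mul (norm_nonneg _), one_div_mul_cancel hn, Real.rpow_one]

/-- The rescaled norm is ultrametric. [cite: NeukirchANT1999, Ch. II Thm. (4.8)] -/
instance instIsUltrametricDist : IsUltrametricDist (RescaledCompletion F p v hv) :=
  inferInstance

/-- Closed balls of the rescaled norm are closed balls of `F_v`. [cite: NeukirchANT1999, Ch. II Thm. (4.8)] -/
theorem closedBall_eq (x : RescaledCompletion F p v hv) {r : ℝ} (hr : 0 ≤ r) :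
    (closedBall x r : Set (RescaledCompletion F p v hv)) =
      of F p v hv '' closedBall ((of F p v hv).symm x) (r ^ (localDeg F v)) := by
  ext y
  rw [show (⇑(of F p v hv) : v.adicCompletion F → RescaledCompletion F p v hv) = (of F p v hv).toEquiv from rfl,
    Equiv.image_eq_preimage_symm]
  simp only [Metric.mem_closedBall, Set.mem_preimage, dist_eq_norm]
  change _ ↔ ‖(of F p v hv).symm y - (of F p v hv).symm x‖ ≤ _
  rw [← map_sub, norm_eq_norm_of_pow F p v hv ((of F p v hv).symm (y - x))]
  change ‖y - x‖ ≤ r ↔ ‖y - x‖ ^ localDeg F v ≤ _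
  exact (pow_le_pow_iff_left₀ (norm_nonneg _) hr (localDeg_pos F v).ne').symm

/-- `RescaledCompletion` is proper (closed balls compact — they are closed balls of the locally compact
`F_v`). [cite: WeilBNT1967, Ch. I §4, Th. 6] -/
instance instProperSpace : ProperSpace (RescaledCompletion F p v hv) := by
  letI : NontriviallyNormedField (v.adicCompletion F) := Ultrametric.AdicCompletion.nontriviallyNormedField F v
  haveI := Literature.NumberTheory.Automorphic.properSpace_adicCompletion F v
  refine ⟨fun x r => ?_⟩
  rcases lt_or_ge r 0 with hr | hr
  · rw [Metric.closedBall_eq_empty.mpr hr]; exact isCompact_empty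
  · rw [closedBall_eq F p v hv x hr]
    exact (isCompact_closedBall _ _).image continuous_id

/-! ### `‖c‖' = |c|_p`: a normed `ℚ_p`-algebra -/

variable [Fact p.Prime]

/-- **The canonical `ℚ_p`-algebra structure** (`LocalField.adicCompletionPadicAlgebra`, the unique
continuous `ℚ_p → F_v`). [cite: NeukirchANT1999, Ch. II Prop. (5.2)] -/
instance instAlgebra : Algebra ℚ_[p] (RescaledCompletion F p v hv) :=
  (LocalField.adicCompletionPadicAlgebra v p hv : Algebra ℚ_[p] (v.adicCompletion F))

/-- `n_v = [F_v : ℚ_p]` for the canonical `ℚ_p`-algebra structure (`CompletionLocalDegree`).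
[cite: NeukirchANT1999, Ch. II Prop. (6.8)] -/
theorem localDeg_eq_finrank :
    letI := LocalField.adicCompletionPadicAlgebra v p hv
    localDeg F v = Module.finrank ℚ_[p] (v.adicCompletion F) := by
  rw [localDeg, finrank_adicCompletionPadicAlgebra_eq p v hv]


/-- The `ℚ_p`-algebra map of the rescaled completion is that of `F_v`. [cite: NeukirchANT1999, Ch. II Prop. (5.2)] -/
theorem algebraMap_eq (c : ℚ_[p]) :
    algebraMap ℚ_[p] (RescaledCompletion F p v hv) c =
      of F p v hv (letI := LocalField.adicCompletionPadicAlgebra v p hv; algebraMap ℚ_[p] (v.adicCompletion F) c) :=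
  rfl

/-- **`‖algebraMap c‖_v = |c|_p^{n_v}`** on `F_v` with Mathlib's norm: both sides are the Haar modulus of
multiplication by `c` on the `n_v`-dimensional `ℚ_p`-vector space `F_v` (`mod_{F_v}(y) = ‖y‖_v`,
`mod_W(c) = |c|_p^{dim W}`). [cite: WeilBNT1967, Ch. I §4, Th. 6] -/
theorem norm_algebraMap_adicCompletion (c : ℚ_[p]) :
    letI := LocalField.adicCompletionPadicAlgebra v p hv
    ‖algebraMap ℚ_[p] (v.adicCompletion F) c‖ = ‖c‖ ^ (localDeg F v) := by
  letI := LocalField.adicCompletionPadicAlgebra v p hv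
  letI : NontriviallyNormedField (v.adicCompletion F) := Ultrametric.AdicCompletion.nontriviallyNormedField F v
  haveI := Literature.NumberTheory.Automorphic.properSpace_adicCompletion F v
  rcases eq_or_ne c 0 with rfl | hc
  · simp [(localDeg_pos F v).ne']
  -- the module topology on `F_v`
  haveI : ContinuousSMul ℚ_[p] (v.adicCompletion F) := continuousSMul_of_algebraMap ℚ_[p] _
    (LocalField.continuous_algebraMap_adicCompletionPadicAlgebra v p hv)
  haveI : FiniteDimensional ℚ_[p] (v.adicCompletion F) := by
    apply Module.finite_of_finrank_pos
    rw [← localDeg_eq_finrank]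
    exact localDeg_pos F v
  haveI : IsModuleTopology ℚ_[p] (v.adicCompletion F) := isModuleTopologyOfFiniteDimensional
  borelize (v.adicCompletion F)
  -- the unit `algebraMap c` and its modulus
  let u : (v.adicCompletion F)ˣ := Units.map (algebraMap ℚ_[p] (v.adicCompletion F) : ℚ_[p] →* _) (Units.mk0 c hc)
  have hmod₁ := Literature.IUT.LogVolume.CompletionModel.distribHaarChar_eq_norm F v u
  -- the same modulus computed as a scalar
  have hmod₂ : distribHaarChar (v.adicCompletion F) u = distribHaarChar (v.adicCompletion F) (Units.mk0 c hc) := by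
    set μ : Measure (v.adicCompletion F) := MeasureTheory.Measure.addHaar
    obtain ⟨K⟩ := (inferInstance : Nonempty (TopologicalSpace.PositiveCompacts (v.adicCompletion F)))
    have hK0 : μ (K : Set _) ≠ 0 := (MeasureTheory.Measure.measure_pos_of_nonempty_interior _ K.interior_nonempty).ne'
    have hKt : μ (K : Set _) ≠ ⊤ := K.isCompact.measure_lt_top.ne
    refine distribHaarChar_eq_of_measure_smul_eq_mul (μ := μ) hK0 hKt ?_
    have hset : u • (K : Set (v.adicCompletion F)) = (Units.mk0 c hc) • (K : Set _) := by
      ext x; simp only [Set.mem_smul_set, Units.smul_def, smul_eq_mul, u, Units.coe_map, MonoidHom.coe_coe,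
        Units.val_mk0, Algebra.smul_def]
    rw [hset, distribHaarChar_mul]
  rw [hmod₂, Literature.IUT.LogVolume.PadicModule.distribHaarChar_units_smul p (v.adicCompletion F),
    Literature.IUT.LogVolume.distribHaarChar_padic_eq_nnnorm, ← localDeg_eq_finrank] at hmod₁
  rw [show algebraMap ℚ_[p] (v.adicCompletion F) c = (u : v.adicCompletion F) from rfl, ← hmod₁]
  simp

/-- **The rescaled completion is a normed `ℚ_p`-algebra: `‖algebraMap c‖' = |c|_p`.**
[cite: NeukirchANT1999, Ch. II Thm. (4.8)] -/
theorem norm_algebraMap (c : ℚ_[p]) : ‖algebraMap ℚ_[p] (RescaledCompletion F p v hv) c‖ = ‖c‖ := by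
  have hn : (localDeg F v : ℝ) ≠ 0 := by exact_mod_cast (localDeg_pos F v).ne'
  rw [algebraMap_eq, norm_of, norm_algebraMap_adicCompletion, ← Real.rpow_natCast,
    ← Real.rpow_mul (norm_nonneg _), mul_one_div_cancel hn, Real.rpow_one]

/-- `RescaledCompletion` is a normed `ℚ_p`-algebra. [cite: NeukirchANT1999, Ch. II Thm. (4.8)] -/
instance instNormedAlgebra : NormedAlgebra ℚ_[p] (RescaledCompletion F p v hv) :=
  { instAlgebra F p v hv with
    norm_smul_le := fun c x => by
      rw [Algebra.smul_def, norm_mul, norm_algebraMap] }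

/-- `RescaledCompletion` is nontrivially normed (`‖p‖' = p⁻¹ ≠ 1`). [cite: NeukirchANT1999, Ch. II Thm. (4.8)] -/
instance instNontriviallyNormedField : NontriviallyNormedField (RescaledCompletion F p v hv) :=
  NontriviallyNormedField.ofNormNeOne ⟨algebraMap ℚ_[p] _ (p : ℚ_[p]), by
    refine ⟨?_, ?_⟩
    · rw [Ne, map_eq_zero_iff _ (algebraMap ℚ_[p] (RescaledCompletion F p v hv)).injective]
      exact Nat.cast_ne_zero.mpr (Fact.out : p.Prime).ne_zero
    · rw [norm_algebraMap, Padic.norm_p]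
      have : (1 : ℝ) < p := by exact_mod_cast (Fact.out : p.Prime).one_lt
      exact (inv_lt_one_of_one_lt₀ this).ne⟩

end RescaledCompletion

end Literature.NumberTheory.NumberFields

end
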